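import Literature.AnabelianGeometry.EtaleTheta.KummerMap

/-!
# Functoriality of the Kummer map on the colimits (LANA §6.1, p.32), completed

Source: LANA Project interim report [LANA2026Report], §6.1, p. 32: for an equivariant co-morphism
`(φ_*, φ^*) : (G_Y, M_Y) → (G_X, M_X)` "such that each `H` in the `G_X`-system contains `φ_*(H')` for
some `H'` in the `G_Y`-system", the map `λ : Λ(M_X) → Λ(M_Y)` "induces a map
`lim_{→ H} H¹(H, Λ(M_X)) → lim_{→ H'} H¹(H', Λ(M_Y))`. It is easy to see that this map is compatible
with the Kummer maps in the sense that the following square commutes: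
`κ_Y ∘ φ^* = (induced map) ∘ κ_X`."

## What is here (proved)

* `CoMorphism.comp` and `CoMorphism.H1Map_comp` : the `H¹`-maps of co-morphisms compose
  (Mathlib `groupCohomology.map_comp` + `map_congr`); `H1Map_congr`, `H1Map_resH1`, `resH1_H1Map` :
  compatibility with the restriction maps of the two systems;
* `CoMorphism.colimMap` : the induced map of colimits, defined by the universal property of the direct
  limit from a choice `k` of, for each `H = S_X i`, an `H' = S_Y (k i)` with `φ_*(H') ⊆ H`
  (well-definedness = the compatibility proof `colimMap_compat`);
* `CoMorphism.colimMap_kummerMap` : **the commuting square** `colimMap (κ_X a) = κ_Y (φ^* a)`.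
-/

namespace Literature.AnabelianGeometry.EtaleTheta

open groupCohomology CategoryTheory

namespace CoMorphism

section Comp

variable {GX AX GY AY GZ AZ : Type*} [Group GX] [CommGroup AX] [MulDistribMulAction GX AX]
  [Group GY] [CommGroup AY] [MulDistribMulAction GY AY] [Group GZ] [CommGroup AZ]
  [MulDistribMulAction GZ AZ]

/-- Composition of co-morphisms `(G_Z, A_Z) → (G_Y, A_Y) → (G_X, A_X)`.
[cite: LANA2026Report, §6.1 p.32] -/
def comp (c : CoMorphism GX AX GY AY) (c' : CoMorphism GY AY GZ AZ) : CoMorphism GX AX GZ AZ where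
  groupHom := c.groupHom.comp c'.groupHom
  map := c'.map.comp c.map
  map_smul γ m := by
    change c'.map (c.map (c.groupHom (c'.groupHom γ) • m)) = γ • c'.map (c.map m)
    rw [c.map_smul, c'.map_smul]

end Comp

section H1

variable {GX AX GY AY GZ AZ : Type} [Group GX] [CommGroup AX] [MulDistribMulAction GX AX]
  [Group GY] [CommGroup AY] [MulDistribMulAction GY AY] [Group GZ] [CommGroup AZ]
  [MulDistribMulAction GZ AZ]

/-- Two co-morphisms with the same underlying homomorphisms have the same `H¹`-maps between the same
levels (`groupCohomology.map_congr`). [cite: LANA2026Report, §6.1 p.32] -/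
theorem H1Map_congr (c d : CoMorphism GX AX GY AY) (hg : c.groupHom = d.groupHom) (hm : c.map = d.map)
    {H : Subgroup GX} {H' : Subgroup GY} (hc : H'.map c.groupHom ≤ H) (hd : H'.map d.groupHom ≤ H) :
    c.H1Map hc = d.H1Map hd := by
  obtain ⟨cg, cm, _⟩ := c
  obtain ⟨dg, dm, _⟩ := d
  cases hg
  cases hm
  rfl

/-- The `H¹`-maps compose: `H¹(H, Λ A_X) → H¹(H', Λ A_Y) → H¹(H'', Λ A_Z)` is the `H¹`-map of the
composite co-morphism. [cite: LANA2026Report, §6.1 p.32] -/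
theorem H1Map_comp (c : CoMorphism GX AX GY AY) (c' : CoMorphism GY AY GZ AZ)
    {H : Subgroup GX} {H' : Subgroup GY} {H'' : Subgroup GZ} (h₁ : H'.map c.groupHom ≤ H)
    (h₂ : H''.map c'.groupHom ≤ H') (h₃ : H''.map (c.comp c').groupHom ≤ H) :
    c.H1Map h₁ ≫ c'.H1Map h₂ = (c.comp c').H1Map h₃ := by
  rw [H1Map, H1Map, H1Map, ← groupCohomology.map_comp]
  exact groupCohomology.map_congr (MonoidHom.ext fun _ => Subtype.ext rfl)
    (LinearMap.ext fun _ => rfl) 1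

end H1

section Colim

variable {GX AX GY AY : Type} [Group GX] [CommGroup AX] [MulDistribMulAction GX AX]
  [Group GY] [CommGroup AY] [MulDistribMulAction GY AY] (c : CoMorphism GX AX GY AY)
  {ι : Type} [Preorder ι] [DecidableEq ι] (SX : ι → Subgroup GX)
  (hSX : ∀ ⦃i j : ι⦄, i ≤ j → SX j ≤ SX i)
  {κ : Type} [Preorder κ] [DecidableEq κ] [IsDirectedOrder κ] (SY : κ → Subgroup GY)
  (hSY : ∀ ⦃i j : κ⦄, i ≤ j → SY j ≤ SY i)
  (k : ι → κ) (hk : ∀ i, (SY (k i)).map c.groupHom ≤ SX i)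

/-- The level-wise pieces of the induced map: `H¹(S_X i, Λ A_X) → H¹(S_Y (k i), Λ A_Y) → lim_Y`.
[cite: LANA2026Report, §6.1 p.32] -/
noncomputable def colimMapAux (i : ι) : H1 (cyclotomeRep (A := AX) (SX i)) →+ H1Colimit AY SY hSY :=
  (toColimit (A := AY) SY hSY (k i)).comp (c.H1Map (H := SX i) (hk i)).hom.toAddMonoidHom

/-- Restricting on the `X`-side first does not change the `H¹`-map of `c` into a fixed `Y`-level.
[cite: LANA2026Report, §6.1 p.32] -/
theorem H1Map_resH1 {H₁ H₂ : Subgroup GX} {H' : Subgroup GY} (hX : H₂ ≤ H₁)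
    (h₁ : H'.map c.groupHom ≤ H₂) (h₂ : H'.map c.groupHom ≤ H₁) (x : H1 (cyclotomeRep (A := AX) H₁)) :
    c.H1Map h₁ (resH1 hX x) = c.H1Map h₂ x := by
  have hle : H'.map ((refl GX AX).comp c).groupHom ≤ H₁ := by
    change H'.map ((MonoidHom.id GX).comp c.groupHom) ≤ H₁
    rw [MonoidHom.id_comp]; exact h₂
  have e₁ : (refl GX AX).H1Map (refl_cond hX) ≫ c.H1Map h₁ = ((refl GX AX).comp c).H1Map hle :=
    H1Map_comp _ _ _ _ _
  have hg : ((refl GX AX).comp c).groupHom = c.groupHom := by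
    change (MonoidHom.id GX).comp c.groupHom = _
    rw [MonoidHom.id_comp]
  have hm : ((refl GX AX).comp c).map = c.map := by
    change c.map.comp (MonoidHom.id AX) = _
    rw [MonoidHom.comp_id]
  have e₂ : ((refl GX AX).comp c).H1Map hle = c.H1Map h₂ := H1Map_congr _ _ hg hm _ _
  change (c.H1Map h₁).hom (((refl GX AX).H1Map (refl_cond hX)).hom x) = _
  rw [← ModuleCat.comp_apply, e₁, e₂]

/-- Restricting on the `Y`-side afterwards does not change the `H¹`-map of `c` out of a fixed
`X`-level. [cite: LANA2026Report, §6.1 p.32] -/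
theorem resH1_H1Map {H : Subgroup GX} {H₁' H₂' : Subgroup GY} (hY : H₂' ≤ H₁')
    (h₁ : H₁'.map c.groupHom ≤ H) (h₂ : H₂'.map c.groupHom ≤ H) (x : H1 (cyclotomeRep (A := AX) H)) :
    resH1 hY (c.H1Map h₁ x) = c.H1Map h₂ x := by
  have hle : H₂'.map (c.comp (refl GY AY)).groupHom ≤ H := by
    change H₂'.map (c.groupHom.comp (MonoidHom.id GY)) ≤ H
    rw [MonoidHom.comp_id]; exact h₂
  have e₁ : c.H1Map h₁ ≫ (refl GY AY).H1Map (refl_cond hY) = (c.comp (refl GY AY)).H1Map hle :=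
    H1Map_comp _ _ _ _ _
  have hg : (c.comp (refl GY AY)).groupHom = c.groupHom := by
    change c.groupHom.comp (MonoidHom.id GY) = _
    rw [MonoidHom.comp_id]
  have hm : (c.comp (refl GY AY)).map = c.map := by
    change (MonoidHom.id AY).comp c.map = _
    rw [MonoidHom.id_comp]
  have e₂ : (c.comp (refl GY AY)).H1Map hle = c.H1Map h₂ := H1Map_congr _ _ hg hm _ _
  change ((refl GY AY).H1Map (refl_cond hY)).hom ((c.H1Map h₁).hom x) = _
  rw [← ModuleCat.comp_apply, e₁, e₂]

omit [DecidableEq ι] in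
/-- Compatibility of the level-wise pieces with the transition maps of the `X`-system (so that they
descend to the direct limit). [cite: LANA2026Report, §6.1 p.32] -/
theorem colimMap_compat (i j : ι) (hij : i ≤ j) (x : H1 (cyclotomeRep (A := AX) (SX i))) :
    c.colimMapAux SX SY hSY k hk j (H1System (A := AX) SX hSX i j hij x) =
      c.colimMapAux SX SY hSY k hk i x := by
  obtain ⟨m, him, hjm⟩ := exists_ge_ge (k i) (k j)
  have hmi : (SY m).map c.groupHom ≤ SX i := (Subgroup.map_mono (hSY him)).trans (hk i)
  have hmj : (SY m).map c.groupHom ≤ SX j := (Subgroup.map_mono (hSY hjm)).trans (hk j)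
  change toColimit SY hSY (k j) (c.H1Map (hk j) (resH1 (hSX hij) x)) =
    toColimit SY hSY (k i) (c.H1Map (hk i) x)
  rw [← AddCommGroup.DirectLimit.of_f (f := H1System (A := AY) SY hSY) hjm,
    ← AddCommGroup.DirectLimit.of_f (f := H1System (A := AY) SY hSY) him]
  change toColimit SY hSY m (resH1 (hSY hjm) (c.H1Map (hk j) (resH1 (hSX hij) x))) =
    toColimit SY hSY m (resH1 (hSY him) (c.H1Map (hk i) x))
  rw [c.resH1_H1Map (hSY hjm) (hk j) hmj, c.H1Map_resH1 (hSX hij) hmj hmi,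
    c.resH1_H1Map (hSY him) (hk i) hmi]

/-- **The induced map of colimits** `lim_{→ i} H¹(S_X i, Λ A_X) → lim_{→ k} H¹(S_Y k, Λ A_Y)`
[cite: LANA2026Report, §6.1 p.32], from a choice `k` witnessing "each `H` in the `G_X`-system contains
`φ_*(H')` for some `H'` in the `G_Y`-system". -/
noncomputable def colimMap : H1Colimit AX SX hSX →+ H1Colimit AY SY hSY :=
  AddCommGroup.DirectLimit.lift (fun i => H1 (cyclotomeRep (A := AX) (SX i))) (H1System (A := AX) SX hSX)
    _ (c.colimMapAux SX SY hSY k hk) (c.colimMap_compat SX hSX SY hSY k hk)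

/-- `colimMap` on the image of a level-`i` class. [cite: LANA2026Report, §6.1 p.32] -/
theorem colimMap_toColimit (i : ι) (x : H1 (cyclotomeRep (A := AX) (SX i))) :
    c.colimMap SX hSX SY hSY k hk (toColimit SX hSX i x) = toColimit SY hSY (k i) (c.H1Map (hk i) x) :=
  AddCommGroup.DirectLimit.lift_of _ (c.colimMapAux SX SY hSY k hk) (c.colimMap_compat SX hSX SY hSY k hk) i x

variable [IsDirectedOrder ι] [RootableBy AX ℕ] [RootableBy AY ℕ]

/-- **The functoriality square on the colimits** [cite: LANA2026Report, §6.1 p.32]: for the Kummer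
maps `κ_X`, `κ_Y` of `KummerMap.lean`, `colimMap (κ_X a) = κ_Y (φ^* a)`. -/
theorem colimMap_kummerMap (hcX : IsExhausted AX SX) (hcY : IsExhausted AY SY) (a : AX) :
    c.colimMap SX hSX SY hSY k hk (kummerMap hSX hcX a) = kummerMap hSY hcY (c.map a) := by
  obtain ⟨i, hi⟩ := hcX a
  have hi' : c.map a ∈ invariants (A := AY) (SY (k i)) := c.map_mem_fixedPoints (hk i) hi
  rw [kummerMap_eq_of hSX hcX a i hi, colimMap_toColimit, kummerMap_eq_of hSY hcY (c.map a) (k i) hi']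
  congr 1
  exact c.map_kummerClass (hk i) ⟨a, hi⟩

end Colim

end CoMorphism

end Literature.AnabelianGeometry.EtaleTheta
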